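import Summits.ResolutionOfSingularities.ResolutionOfSingularities.Theorems.PurelyInseparableDim4Target
import Summits.ResolutionOfSingularities.ResolutionOfSingularities.Theorems.PurelyInseparableDim4Rules
import Summits.ResolutionOfSingularities.ResolutionOfSingularities.Theorems.PurelyInseparableDim4Scope
import Summits.ResolutionOfSingularities.ResolutionOfSingularities.Theorems.PurelyInseparableDim4SpineGame
import Summits.ResolutionOfSingularities.ResolutionOfSingularities.Theorems.PurelyInseparableDim4Perm2BoundOrigin
import HarnessLib

/-!
# [OURS · res-dim4-pi PR-9a] LEMMA D1: a positional win of the PURE polyhedra game wins the SPINE game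

Cell `res-dim4-pi` (D-0157 DOOR 2, wave 2), brick **PR-9a** (desk `boards/WAVE2.md` §F, WORD #22 /
#23 (b)), seat `res-dim4-p-10` («width 10»).  Typed over the desk's spine-game frame
(`PurelyInseparableDim4SpineGame`: `SpinePos`, `SpinePermissible`, `pureMove`, `spineMove`, `SpineWon`,
`IsPurePlay`, `IsSpinePlay`, `IsPurePositionalWin`, `IsSpinePositionalWin`, `PurePositionalWin4`,
`PositionalWin4`) and `res-dim4-p-2`'s chart-origin dictionary
(`Perm2Bound.isPthPowerExponent_chartExponent_iff`, p646720); nothing is restated.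

## What is proved (every exponent `q`)
* `SpineD1.not_forall_dvd_of_mem_spineMove` — after ONE spine move every point of the position is
  `q`-clean (some coordinate not divisible by `q`): the deletion is built into `spineMove`.
* `SpineD1.spineMove_eq_pureMove_of_clean` — on a `q`-clean position, for a permissible `J` and a chart
  `j ∈ J`, the spine move IS the pure move (the chart law preserves and reflects `q`-th-power exponents,
  p-2's `isPthPowerExponent_chartExponent_iff`; WORD #23 (b) «no deletions on the spine for cleaned
  states»).
* `SpineD1.isPurePlay_succ_of_isSpinePlay` — hence an infinite spine play of a permissible positional
  strategy, shifted by one move, is an infinite pure play of the same strategy.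
* **`positionalWin4_of_purePositionalWin4 : PurePositionalWin4 q → PositionalWin4 q`** (PR-9a).

[OURS · counted 0 · elementary · AI work weaker than expert review] A statement about OUR spine frame
(a combinatorial game on supports); NOTHING here proves resolution of singularities in dimension ≥ 4 /
characteristic `p`. bears_on: LADDER-RESOLUTION:D157-DOOR2 (res-dim4-pi · PR-9a). Supports
stmt-ResolutionOfSingularities-16155 (helper).
-/

set_option linter.dupNamespace false -- mandated namespace of this single-conjunct summit

namespace Summit.ResolutionOfSingularities.ResolutionOfSingularities.Theorems.PIDim4

namespace SpineD1

open Finset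
open Literature.AlgebraicGeometry.Resolution
open Literature.AlgebraicGeometry.Resolution.Hauser2010

/-- After a spine move no point of the position has all coordinates divisible by `q`
(the cleaning deletion is part of `spineMove`). [folklore] -/
theorem not_forall_dvd_of_mem_spineMove {q : ℕ} {J : Finset (Fin 4)} {j : Fin 4} {A : SpinePos}
    {a : Fin 4 →₀ ℕ} (ha : a ∈ spineMove q J j A) : ¬ ∀ i, q ∣ a i :=
  (Finset.mem_filter.mp ha).2

/-- On a `q`-clean position the spine move along a permissible `J` in a chart `j ∈ J` is the pure move:
the chart law `CentreBlowup.chartExponent` reflects `q`-th-power exponents under condition (1)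
(`res-dim4-p-2`, `Perm2Bound.isPthPowerExponent_chartExponent_iff`). [folklore] -/
theorem spineMove_eq_pureMove_of_clean {q : ℕ} {J : Finset (Fin 4)} {j : Fin 4} {A : SpinePos}
    (hj : j ∈ J) (hperm : SpinePermissible q J A) (hclean : ∀ a ∈ A, ¬ ∀ i, q ∣ a i) :
    spineMove q J j A = pureMove q J j A := by
  unfold spineMove
  refine Finset.filter_true_of_mem fun a' ha' => ?_
  obtain ⟨a, ha, rfl⟩ := Finset.mem_image.mp ha'
  intro hdvd
  refine hclean a ha ?_
  have hP : IsPthPowerExponent q (CentreBlowup.chartExponent q J j a) :=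
    (isPthPowerExponent_iff q _).mpr hdvd
  exact (isPthPowerExponent_iff q a).mp
    ((Perm2Bound.isPthPowerExponent_chartExponent_iff hj (hperm.2 a ha)).mp hP)

/-- An infinite spine play of a strategy that is permissible wherever player A has not yet won becomes,
after dropping its first position, an infinite PURE play of the same strategy. [folklore] -/
theorem isPurePlay_succ_of_isSpinePlay {q : ℕ} {σ : SpineStrategy}
    (hperm : ∀ A, ¬ SpineWon q A → SpinePermissible q (σ A) A) {A : ℕ → SpinePos}
    (hA : IsSpinePlay q σ A) : IsPurePlay q σ fun k => A (k + 1) := by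
  intro k
  obtain ⟨hwon, j, hj, hnext⟩ := hA (k + 1)
  have hclean : ∀ a ∈ A (k + 1), ¬ ∀ i, q ∣ a i := by
    intro a ha
    obtain ⟨-, j₀, -, hk⟩ := hA k
    rw [hk] at ha
    exact not_forall_dvd_of_mem_spineMove ha
  refine ⟨hwon, j, hj, ?_⟩
  show A (k + 1 + 1) = pureMove q (σ (A (k + 1))) j (A (k + 1))
  rw [hnext]
  exact spineMove_eq_pureMove_of_clean hj (hperm _ hwon) hclean

end SpineD1

/-- **PR-9a (LEMMA D1 of the cell).** A positional strategy winning Hironaka's PURE constrained polyhedra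
game in four variables from every position also wins the SPINE game (pure move followed by the deletion of
the `q`-divisible points) from every position. [folklore] -/
theorem positionalWin4_of_purePositionalWin4 (q : ℕ) (h : PurePositionalWin4 q) : PositionalWin4 q := by
  obtain ⟨σ, hperm, hno⟩ := h
  refine ⟨σ, hperm, ?_⟩
  rintro ⟨A, hA⟩
  exact hno ⟨fun k => A (k + 1), SpineD1.isPurePlay_succ_of_isSpinePlay hperm hA⟩

end Summit.ResolutionOfSingularities.ResolutionOfSingularities.Theorems.PIDim4
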